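import Mathlib
import Summits.ValiantsHypothesis.ValiantsHypothesis.Theorems.LacunarySymmetroidMatrixDescartesCensusDefs
import Summits.ValiantsHypothesis.ValiantsHypothesis.Theorems.LacunarySymmetroidMatrixDescartesStubDescartesCeiling
import Summits.ValiantsHypothesis.ValiantsHypothesis.Theorems.LacunarySymmetroidMatrixDescartesDescartesSharpOnSupport
import Summits.ValiantsHypothesis.ValiantsHypothesis.Theorems.KPlusLogSqLawWeakLiftingTowerGraftLawBoundedLetters

/-!
# Tower graft line — THE `m = 2` RUNG OF S5 IS ONE NAMED QUANTITY: the positive-root count of `2 × 2` symmetric pencils on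
# 2-towers, LINEAR OR QUADRATIC IN `K`; and Chattopadhyay's `fg + 1` question is an instance of the census row `(2, d)`

Calibration file for LINE (B) `Cruxes/WeakLifting/Lines/tower_graft.lean` of the crux `WeakLifting` (stmt-ValiantsHypothesis-19561),
registered stub S5 `stub_oneLetterGraftLaw : TowerGraftLaw` (and its rungs S4 `TowerGraftLawId`, S4b `TowerGraftLawCorner`,
S5ᴸ `TowerGraftLawPolylog`).  NO stub is claimed.  The hand leafhand-val-kpluslogsqlaw-1 g2 located the FIRST OPEN FIXED-SIZE RUNG of
S5 as its size-`2` row «`∃ C ∀ K B D (2-tower d), PosRootLawOn 2 K B d → PosRootLawOn 2 (K+1) (2^C B + 2^C) (Fin.snoc d D)`»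
(`…TowerGraftLawSizeOne`: the size-`1` row holds for all `K` with `C = 1`).  This file types what that rung hinges on.

Write `ζ₊(2; d)` for the least `B` with `PosRootLawOn 2 K B d` (distinct positive zeros of `det ∑ₗ X^{dₗ} Sₗ`, `Sₗ` real symmetric
`2 × 2`).  Two tree facts frame the row: the all-support FLOOR `ζ₊(2; d) ≥ 2(K − 1)` (`DescartesSharp.le_of_posRootLawOn`, diagonal
designs) and the Descartes CEILING `ζ₊(2; d ⊔ D) ≤ C(K+2, 2) − 1` (`posRootLawOn_snoc_descartes`).  Hence (§1, bookkeeping):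

* `towerGraftLaw_rowTwo_of_linearCap` — a LINEAR TOWER CAP «`PosRootLawOn 2 K (c·K) d` on every 2-tower» gives the `m = 2` rung
  with `2^C = 2^{c+1}` (indeed `ζ₊(2; d ⊔ D) ≤ c(K+1) ≤ c·B + 2c` since `B ≥ K − 1`);
* `towerGraftLaw_rowTwo_of_quadraticFloor` — a QUADRATIC TOWER FLOOR «`PosRootLawOn 2 K B d → (K+2)(K+1) ≤ c·(B+1)` on every
  2-tower» gives it with factor `c` (`ζ₊(2; d ⊔ D) ≤ C(K+2,2) − 1 ≤ c·B + c`).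

So the rung is decided by the ORDER OF GROWTH in `K` of ONE quantity, the tower row `K ↦ sup_{2-towers d} ζ₊(2; d)`, unless that
growth is irregular.  Which side is live: the tree's exact tropical rows `T(2,K) = 4K − 7` (`TwoRowFamily.tropRootLawAt_two_iff`) and
`T_sym(2,K) = 3K − 4` (`tropRow_two_symm_le`) say patchworking certifies only LINEARLY many zeros at size `2` on any support, and the
format-level records (`VSQ.vsq_law`: `ζ_sym(2,K) ≥ 4K − 7`; census `ζ(2,12) ≥ 34`) are linear too; no superlinear mechanism is known.
The cap side, however, CONTAINS A PRINTED OPEN QUESTION (§2):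

* `det_negMulAddOne_pencil`, ★ `card_posRoots_mul_add_one_le` — for `K`-nomials `f, g` on a common support `d` containing the exponent
  `0`, `fg + 1 = −det [[−f, 1], [1, g]]` is (minus) the determinant of a SYMMETRIC `2 × 2` pencil on `d`, so
  `PosRootLawOn 2 K B d` bounds the positive zeros of `fg + 1` by `B`.  Chattopadhyay's question «is the number of real zeros of
  `fg + 1`, `f, g` `k`-sparse, `O(k)`?» (raised in Koiran–Portier–Tavenas, *A Wronskian approach to the real τ-conjecture*,
  J. Symb. Comput. 2015, acknowledgements; status in Jindal–Pandey–Shukla–Zisopoulos, *How many zeros of a random sparse polynomial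
  are real?*, ISSAC 2020, §1.2: «no bound better than the one given by Descartes' rule of signs is known … no sub-quadratic bound is
  known.  We also do not know of any example where the number of real roots of `fg+1` is super-linear in `k`») is therefore the
  special case `S₀`-entry pattern `[[−f, 1],[1, g]]` of the row `(2, d)`; a linear tower cap proves its TOWER case (common support a
  2-tower through `0`), and a superlinear tower family for the row would in particular be the first superlinear `p² − q² − r²`
  (`det` of a symmetric `2 × 2` pencil is a signature-`(1,2)` quadratic form in the letters).

HONEST FRAMING: two one-line reductions and one identity; nothing on S4/S4b/S5/S5ᴸ, TowerB, `WeakLifting`, Conjecture B /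
`KPlusLogSqLaw`, `MatrixDescartes` (18050) or `VP ≠ VNP`.  The `m = 2` rung stays OPEN; what is new is its address: a fewnomial
UPPER bound of Descartes-beating type on 2-towers (the quadratic-floor route would need a superlinear real mechanism at size 2, of
which neither the tree nor the literature has an example).  Def-free.  Seat: prover leafhand-val-kpluslogsqlaw-1 g3,
`--supports stmt-ValiantsHypothesis-19561`.

[folklore] Descartes' rule; the `fg + 1` question: Koiran–Portier–Tavenas 2015 (doi:10.1016/j.jsc.2014.09.036, acknowledgements),
Jindal–Pandey–Shukla–Zisopoulos 2020 (doi:10.1145/3373207.3404031, §1.2).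
-/

-- `Summit.ValiantsHypothesis.ValiantsHypothesis.…` repeats a component by the D-0017 layout
-- (single-conjunct summit), which the `dupNamespace` linter flags; the name is mandated.
set_option linter.dupNamespace false
set_option autoImplicit false

namespace Summit.ValiantsHypothesis.ValiantsHypothesis.Theorems.KPlusLogSqLaw.TowerGraft

open Polynomial Finset Matrix
open scoped BigOperators Polynomial
open Summit.ValiantsHypothesis.ValiantsHypothesis.Theorems.LacunarySymmetroidMatrixDescartes (PosRootLawOn)
open Summit.ValiantsHypothesis.ValiantsHypothesis.Theorems.LacunarySymmetroidMatrixDescartes.StubDescartesCeiling (pencil_apply)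

namespace RowTwoRung

/-! ## 0. Towers: one more tower-top letter keeps the tower; towers are injective supports -/

/-- Grafting a far letter `D` (`m·dₗ < D` for all `l`) on an `m`-tower gives an `m`-tower. [folklore] -/
theorem tower_snoc {m K D : ℕ} {d : Fin K → ℕ} (hd : ∀ l l' : Fin K, l < l' → m * d l < d l') (hD : ∀ l, m * d l < D) :
    ∀ l l' : Fin (K + 1), l < l' → m * (Fin.snoc d D : Fin (K + 1) → ℕ) l < (Fin.snoc d D : Fin (K + 1) → ℕ) l' := by
  intro l l' h
  have hl : l ≠ Fin.last K := ne_of_lt (lt_of_lt_of_le h (Fin.le_last l'))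
  obtain ⟨i, rfl⟩ := Fin.exists_castSucc_eq.mpr hl
  induction l' using Fin.lastCases with
  | last => simpa using hD i
  | cast j =>
    have hij : i < j := Fin.castSucc_lt_castSucc_iff.mp h
    simpa using hd i j hij

/-- A `2`-tower is a strictly increasing, hence injective, support. [folklore] -/
theorem injective_of_tower_two {K : ℕ} {d : Fin K → ℕ} (hd : ∀ l l' : Fin K, l < l' → 2 * d l < d l') :
    Function.Injective d := by
  have hmono : StrictMono d := fun l l' h => by have := hd l l' h; omega
  exact hmono.injective

/-- On any injective support with `K` letters, a valid size-`2` class budget `B` satisfies `K ≤ B + 1` (the diagonal floor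
`2(K − 1) ≤ B` of `DescartesSharp.le_of_posRootLawOn`, weakened; vacuous for `K ≤ 1`). [folklore] -/
theorem le_succ_of_posRootLawOn_two {K B : ℕ} {d : Fin K → ℕ} (hd : Function.Injective d) (hB : PosRootLawOn 2 K B d) :
    K ≤ B + 1 := by
  rcases Nat.lt_or_ge K 2 with hK | hK
  · omega
  · have h := LacunarySymmetroidMatrixDescartes.DescartesSharp.le_of_posRootLawOn (m := 2) (by norm_num) hK hd hB
    omega

/-! ## 1. The `m = 2` rung of S5 from a linear tower cap, or from a quadratic tower floor -/

/-- **LINEAR TOWER CAP ⇒ the `m = 2` rung, explicit form**: if every `2 × 2` symmetric pencil on every 2-tower with `K` letters has at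
most `c·K` positive determinant zeros, then grafting one tower-top letter costs `B ↦ c·B + 2c` at size `2`. [this work; bookkeeping] -/
theorem rowTwoRung_of_linearCap (c : ℕ)
    (hcap : ∀ (K : ℕ) (d : Fin K → ℕ), (∀ l l' : Fin K, l < l' → 2 * d l < d l') → PosRootLawOn 2 K (c * K) d) :
    ∀ (K B D : ℕ) (d : Fin K → ℕ), (∀ l l' : Fin K, l < l' → 2 * d l < d l') → (∀ l, 2 * d l < D) →
      PosRootLawOn 2 K B d → PosRootLawOn 2 (K + 1) (c * B + 2 * c) (Fin.snoc d D) := by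
  intro K B D d hd hD hB S hS
  have hcapK := hcap (K + 1) (Fin.snoc d D) (tower_snoc hd hD) S hS
  have hKB : K ≤ B + 1 := le_succ_of_posRootLawOn_two (injective_of_tower_two hd) hB
  have hmul : c * (K + 1) ≤ c * (B + 2) := Nat.mul_le_mul_left c (by omega)
  calc _ ≤ c * (K + 1) := hcapK
    _ ≤ c * B + 2 * c := by rw [show c * B + 2 * c = c * (B + 2) by ring]; exact hmul

/-- **LINEAR TOWER CAP ⇒ the `m = 2` rung of S5 VERBATIM** (`TowerGraftLaw` at `m = 2`, constant `C = c + 1`; `Nat.log 2 2 = 1`).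
[this work; bookkeeping] -/
theorem towerGraftLaw_rowTwo_of_linearCap (c : ℕ)
    (hcap : ∀ (K : ℕ) (d : Fin K → ℕ), (∀ l l' : Fin K, l < l' → 2 * d l < d l') → PosRootLawOn 2 K (c * K) d) :
    ∃ C : ℕ, ∀ (K B D : ℕ) (d : Fin K → ℕ), (∀ l l' : Fin K, l < l' → 2 * d l < d l') → (∀ l, 2 * d l < D) →
      PosRootLawOn 2 K B d → PosRootLawOn 2 (K + 1) (2 ^ C * B + 2 ^ (C * Nat.log 2 2 ^ 2)) (Fin.snoc d D) := by
  refine ⟨c + 1, fun K B D d hd hD hB S hS => ?_⟩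
  have h := rowTwoRung_of_linearCap c hcap K B D d hd hD hB S hS
  have hlog : Nat.log 2 2 = 1 := Nat.log_eq_one_iff'.mpr ⟨le_rfl, by norm_num⟩
  rw [hlog, one_pow, mul_one]
  have hc : c ≤ 2 ^ c := Nat.lt_two_pow_self.le
  have h2c : 2 * c ≤ 2 ^ (c + 1) := by rw [pow_succ]; omega
  have hcB : c * B ≤ 2 ^ (c + 1) * B := Nat.mul_le_mul_right B (by rw [pow_succ]; omega)
  exact h.trans (Nat.add_le_add hcB h2c)

/-- **QUADRATIC TOWER FLOOR ⇒ the `m = 2` rung, explicit form**: if on every 2-tower every valid size-`2` class budget `B` satisfies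
`(K+2)(K+1) ≤ c·(B+1)`, then grafting one tower-top letter costs `B ↦ c·B + c` at size `2` (Descartes' ceiling `C(K+2,2) − 1` for the
grafted support). [this work; bookkeeping] -/
theorem rowTwoRung_of_quadraticFloor (c : ℕ)
    (hfloor : ∀ (K B : ℕ) (d : Fin K → ℕ), (∀ l l' : Fin K, l < l' → 2 * d l < d l') → PosRootLawOn 2 K B d →
      (K + 2) * (K + 1) ≤ c * (B + 1)) :
    ∀ (K B D : ℕ) (d : Fin K → ℕ), (∀ l l' : Fin K, l < l' → 2 * d l < d l') → (∀ l, 2 * d l < D) →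
      PosRootLawOn 2 K B d → PosRootLawOn 2 (K + 1) (c * B + c) (Fin.snoc d D) := by
  intro K B D d hd _hD hB S hS
  have hdesc := posRootLawOn_snoc_descartes 2 K D d S hS
  have hq := hfloor K B d hd hB
  have hchoose : (2 + K).choose 2 * 2 = (K + 2) * (K + 1) := by
    have h := Nat.choose_two_right (K + 2)
    rw [show 2 + K = K + 2 by ring, h]
    rcases Nat.even_or_odd (K + 2) with ⟨r, hr⟩ | ⟨r, hr⟩
    · rw [hr]; rw [show r + r = 2 * r by ring]
      rw [show 2 * r * (2 * r - 1) / 2 = r * (2 * r - 1) by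
        rw [show 2 * r * (2 * r - 1) = r * (2 * r - 1) * 2 by ring]; exact Nat.mul_div_cancel _ two_pos]
      have : 2 * r - 1 + 0 = K + 1 := by omega
      rw [show K + 1 = 2 * r - 1 by omega]; ring
    · rw [hr, show 2 * r + 1 - 1 = 2 * r by omega,
        show (2 * r + 1) * (2 * r) / 2 = (2 * r + 1) * r by
          rw [show (2 * r + 1) * (2 * r) = (2 * r + 1) * r * 2 by ring]; exact Nat.mul_div_cancel _ two_pos]
      rw [show K + 1 = 2 * r by omega]; ring
  -- `card ≤ C(K+2,2) − 1` and `2·C(K+2,2) = (K+2)(K+1) ≤ c(B+1)` give `2·card + 2 ≤ cB + c`, so `card ≤ cB + c`.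
  have h2 : ((((∑ l, (X : ℝ[X]) ^ (Fin.snoc d D : Fin (K + 1) → ℕ) l • ((S l).map C)).det.roots.toFinset.filter
      (fun t => 0 < t)).card) + 1) * 2 ≤ c * (B + 1) := by
    have hpos : 1 ≤ (2 + K).choose 2 := Nat.succ_le_of_lt (Nat.choose_pos (by omega))
    calc _ ≤ (2 + K).choose 2 * 2 := Nat.mul_le_mul_right 2 (by omega)
      _ = (K + 2) * (K + 1) := hchoose
      _ ≤ c * (B + 1) := hq
  nlinarith [h2]

/-! ## 2. Chattopadhyay's `fg + 1` is a symmetric `2 × 2` lacunary determinant on the common support -/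

/-- the letters of the pencil `[[−f, 𝟙_{l = l₀}], [𝟙_{l = l₀}, g]]`. -/
theorem negMulAddOne_letter_isSymm {K : ℕ} (f g : Fin K → ℝ) (l₀ l : Fin K) :
    (!![-(f l), (if l = l₀ then (1 : ℝ) else 0); (if l = l₀ then (1 : ℝ) else 0), g l] : Matrix (Fin 2) (Fin 2) ℝ).IsSymm := by
  rw [Matrix.IsSymm]
  ext i j
  fin_cases i <;> fin_cases j <;> rfl

/-- **`fg + 1` AS A SYMMETRIC DETERMINANT.**  For `K`-nomials `f = ∑ₗ fₗ X^{dₗ}`, `g = ∑ₗ gₗ X^{dₗ}` on a common support `d` with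
`d l₀ = 0`, the symmetric pencil with letters `[[−fₗ, 𝟙_{l = l₀}], [𝟙_{l = l₀}, gₗ]]` has determinant `−(f·g + 1)`. [folklore] -/
theorem det_negMulAddOne_pencil {K : ℕ} (d : Fin K → ℕ) (f g : Fin K → ℝ) (l₀ : Fin K) (hl₀ : d l₀ = 0) :
    (∑ l, (X : ℝ[X]) ^ d l •
        ((!![-(f l), (if l = l₀ then (1 : ℝ) else 0); (if l = l₀ then (1 : ℝ) else 0), g l] :
          Matrix (Fin 2) (Fin 2) ℝ).map C)).det =
      -((∑ l, C (f l) * X ^ d l) * (∑ l, C (g l) * X ^ d l) + 1) := by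
  rw [Matrix.det_fin_two, pencil_apply, pencil_apply, pencil_apply, pencil_apply]
  simp only [Matrix.of_apply, Matrix.cons_val', Matrix.cons_val_zero, Matrix.cons_val_one, Matrix.empty_val',
    Matrix.cons_val_fin_one]
  have hone : ∑ l, (X : ℝ[X]) ^ d l * C (if l = l₀ then (1 : ℝ) else 0) = 1 := by
    rw [Finset.sum_eq_single l₀]
    · simp [hl₀]
    · intro b _ hb; simp [hb]
    · intro h; exact absurd (Finset.mem_univ l₀) h
  rw [hone]
  have hf : ∑ l, (X : ℝ[X]) ^ d l * C (-(f l)) = -∑ l, C (f l) * X ^ d l := by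
    rw [← Finset.sum_neg_distrib]; refine Finset.sum_congr rfl fun l _ => ?_; rw [C_neg]; ring
  have hg : ∑ l, (X : ℝ[X]) ^ d l * C (g l) = ∑ l, C (g l) * X ^ d l := Finset.sum_congr rfl fun l _ => mul_comm _ _
  rw [hf, hg]; ring

/-- ★ **THE CENSUS ROW `(2, d)` BOUNDS `fg + 1`.**  If every real symmetric `2 × 2` lacunary pencil on the support `d` (which
contains the exponent `0`) has at most `B` distinct positive determinant zeros, then for all `K`-nomials `f, g` on `d` the polynomial
`f·g + 1` has at most `B` distinct positive zeros.  In particular a linear law `PosRootLawOn 2 K (c·K) d` on a class of supports answers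
Chattopadhyay's question (Koiran–Portier–Tavenas 2015; open per Jindal–Pandey–Shukla–Zisopoulos 2020 §1.2) on that class, for
positive zeros (negative ones: `X ↦ −X` keeps the support). [this work] -/
theorem card_posRoots_mul_add_one_le {K B : ℕ} {d : Fin K → ℕ} (hB : PosRootLawOn 2 K B d) (l₀ : Fin K) (hl₀ : d l₀ = 0)
    (f g : Fin K → ℝ) :
    ((((∑ l, C (f l) * X ^ d l) * (∑ l, C (g l) * X ^ d l) + 1).roots.toFinset.filter (fun t => 0 < t)).card) ≤ B := by
  have h := hB (fun l => !![-(f l), (if l = l₀ then (1 : ℝ) else 0); (if l = l₀ then (1 : ℝ) else 0), g l])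
    (fun l => negMulAddOne_letter_isSymm f g l₀ l)
  rw [det_negMulAddOne_pencil d f g l₀ hl₀, Polynomial.roots_neg] at h
  exact h

end RowTwoRung

end Summit.ValiantsHypothesis.ValiantsHypothesis.Theorems.KPlusLogSqLaw.TowerGraft
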